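import Literature.Geometry.Manifold.CoveringSpaceManifold
import HarnessLib

/-!
# The level function of the infinite cyclic cover has no critical points exactly over the
points where the circle map is a submersion

For the infinite cyclic cover `X̂ = CircleMaps.CyclicCover f` of a `C^∞` manifold `X` along a
smooth `f : X → S¹` (Mathlib's `Circle`; `InfiniteCyclicCover.lean`, `CoveringSpaceManifold.lean`)
the level function is a real lift of `f`: `f ∘ proj = exp ∘ level` (`CyclicCover.apply_proj`).
Differentiating (chain rule through the bijective differential of the local diffeomorphism `proj`
and the injective differential of the local diffeomorphism `exp : ℝ → S¹`):

* `injective_mfderiv_circleExp` — `d(exp)_t : ℝ → T_{exp t} S¹` is injective (its composite with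
  the inclusion `S¹ ⊆ ℂ` is `t ↦ e^{it}`, with derivative `i e^{it} ≠ 0`);
* `surjective_mfderiv_circle_iff_ne_zero` — a differential into the line `T S¹` is onto iff it
  is non-zero;
* `mfderiv_level_ne_zero_iff` — **`d(level)_{x̂} ≠ 0 ↔ df_{proj x̂}` is onto**; hence
  `forall_mfderiv_level_ne_zero_iff`: **the level function has no critical points iff `f` is a
  submersion** — the trivial case of the equivariant fibration problem on the cover (an
  equivariant function without critical points, `AlmostNonnegRicciFibrationCoverReduction.lean`)
  in which `f` itself already fibres `X` over the circle.

Everything is proved; no definitions, no named facts.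

## References

* J. M. Lee, *Introduction to Smooth Manifolds*, 2nd ed. (2012), Prop. 4.40 (smooth covering
  maps are local diffeomorphisms), Thm. 4.29. [LeeSmoothManifolds2013]
* A. Hatcher, *Algebraic Topology*, CUP (2002), §1.3 (the cover `ℝ → S¹` and its pull-backs).
  [HatcherAT2002]
-/

noncomputable section

open scoped Manifold ContDiff Topology Real
open Function Set Filter

namespace Literature.Geometry.Manifold

open Literature.Topology.FourManifolds Literature.Topology.FourManifolds.CircleMaps
  Literature.Topology.FourManifolds.CircleMaps.CyclicCover

/-! ### The differential of `exp : ℝ → S¹` is injective -/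

section CircleExp

/-- The inclusion `S¹ ⊆ ℂ` composed with `exp` is `t ↦ e^{it}`, with derivative `i e^{it}`.
[folklore] -/
theorem hasDerivAt_coe_circleExp (t : ℝ) :
    HasDerivAt (fun s : ℝ ↦ ((Circle.exp s : Circle) : ℂ))
      (Complex.exp (t * Complex.I) * Complex.I) t := by
  have h : (fun s : ℝ ↦ ((Circle.exp s : Circle) : ℂ)) = fun s : ℝ ↦ Complex.exp (s * Complex.I) :=
    funext fun s ↦ Circle.coe_exp s
  rw [h]
  have h1 : HasDerivAt (fun s : ℝ ↦ (s : ℂ) * Complex.I) Complex.I t := by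
    simpa using (Complex.ofRealCLM.hasDerivAt (x := t)).mul_const Complex.I
  exact (Complex.hasDerivAt_exp _).comp t h1

/-- **The differential of `exp : ℝ → S¹` is injective** at every `t` (`exp` is a local
diffeomorphism onto the circle): the differential of `t ↦ e^{it} ∈ ℂ` is `c ↦ c i e^{it} ≠ 0`,
and it factors through `d(exp)_t`. [folklore] -/
theorem injective_mfderiv_circleExp (t : ℝ) :
    Injective (mfderiv 𝓘(ℝ, ℝ) (𝓡 1) Circle.exp t) := by
  haveI : Fact (Module.finrank ℝ ℂ = 1 + 1) := finrank_real_complex_fact'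
  have hexp : MDifferentiableAt 𝓘(ℝ, ℝ) (𝓡 1) Circle.exp t :=
    (contMDiff_circleExp (m := 1)).mdifferentiableAt one_ne_zero
  have hcoe : MDifferentiableAt (𝓡 1) 𝓘(ℝ, ℂ) (fun z : Circle ↦ (z : ℂ)) (Circle.exp t) :=
    (contMDiff_coe_sphere (m := 1) (n := 1)).mdifferentiableAt one_ne_zero
  -- the composite differential applied to `c` is `c • (i e^{it})`
  have hcomp : mfderiv 𝓘(ℝ, ℝ) 𝓘(ℝ, ℂ) (fun s : ℝ ↦ ((Circle.exp s : Circle) : ℂ)) t =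
      (mfderiv (𝓡 1) 𝓘(ℝ, ℂ) (fun z : Circle ↦ (z : ℂ)) (Circle.exp t)).comp
        (mfderiv 𝓘(ℝ, ℝ) (𝓡 1) Circle.exp t) :=
    mfderiv_comp t hcoe hexp
  have hval : ∀ c : ℝ, mfderiv 𝓘(ℝ, ℝ) 𝓘(ℝ, ℂ) (fun s : ℝ ↦ ((Circle.exp s : Circle) : ℂ)) t c =
      (c : ℂ) * (Complex.exp (t * Complex.I) * Complex.I) := fun c ↦ by
    rw [mfderiv_eq_fderiv, (hasDerivAt_coe_circleExp t).hasFDerivAt.fderiv]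
    show c • (Complex.exp (t * Complex.I) * Complex.I) = (c : ℂ) * _
    exact Complex.real_smul
  intro a b hab
  have h := congrArg (⇑(mfderiv (𝓡 1) 𝓘(ℝ, ℂ) (fun z : Circle ↦ (z : ℂ)) (Circle.exp t))) hab
  have ha := hval a
  have hb := hval b
  rw [hcomp, ContinuousLinearMap.comp_apply] at ha hb
  rw [ha, hb] at h
  have hne : Complex.exp (t * Complex.I) * Complex.I ≠ 0 :=
    mul_ne_zero (Complex.exp_ne_zero _) Complex.I_ne_zero
  exact_mod_cast mul_right_cancel₀ hne h

end CircleExp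

/-! ### Onto the line `T S¹` means non-zero -/

section Calculus

variable {E : Type*} [NormedAddCommGroup E] [NormedSpace ℝ E] {H : Type*} [TopologicalSpace H]
  {IM : ModelWithCorners ℝ E H} {M : Type*} [TopologicalSpace M] [ChartedSpace H M]

/-- **Onto the line `T S¹` means non-zero**: the differential of a `Circle`-valued map at a point
is onto iff it is non-zero (`T S¹` is one-dimensional). [folklore] -/
theorem surjective_mfderiv_circle_iff_ne_zero (g : M → Circle) (x : M) :
    Surjective (mfderiv IM (𝓡 1) g x) ↔ mfderiv IM (𝓡 1) g x ≠ 0 := by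
  haveI : Nontrivial (TangentSpace (𝓡 1) (g x)) :=
    (inferInstance : Nontrivial (EuclideanSpace ℝ (Fin 1)))
  have h1 : Module.finrank ℝ (TangentSpace (𝓡 1) (g x)) = 1 := finrank_euclideanSpace_fin
  set T := mfderiv IM (𝓡 1) g x with hT
  constructor
  · intro hs hT0
    obtain ⟨w, hw⟩ := exists_ne (0 : TangentSpace (𝓡 1) (g x))
    obtain ⟨v, hv⟩ := hs w
    rw [hT0] at hv
    exact hw hv.symm
  · intro hT0 w
    obtain ⟨v, hv⟩ : ∃ v, T v ≠ 0 := by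
      by_contra h
      push Not at h
      exact hT0 (ContinuousLinearMap.ext h)
    obtain ⟨c, hc⟩ := (finrank_eq_one_iff_of_nonzero' (T v) hv).1 h1 w
    exact ⟨c • v, by rw [map_smul, hc]⟩

end Calculus

/-! ### Critical points of the level function -/

section Level

variable {E : Type*} [NormedAddCommGroup E] [NormedSpace ℝ E]
  {H : Type*} [TopologicalSpace H] {I : ModelWithCorners ℝ E H}
  {X : Type*} [TopologicalSpace X] [ChartedSpace H X] [IsManifold I ∞ X]
  (f : C(X, Circle))

/-- **`d(level)_{x̂} ≠ 0 ↔ df_{proj x̂}` is onto** for a smooth circle map `f` and the level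
function of its infinite cyclic cover: differentiate `f ∘ proj = exp ∘ level`; `dproj_{x̂}` is
bijective and `d(exp)` injective, so `d(level)_{x̂}` and `df_{proj x̂}` vanish together, and a
non-zero differential into the line `T S¹` is onto. [cite: LeeSmoothManifolds2013, Prop. 4.40] -/
theorem mfderiv_level_ne_zero_iff (hf : ContMDiff I (𝓡 1) ∞ f) (x : CyclicCover f) :
    mfderiv I 𝓘(ℝ, ℝ) (level : CyclicCover f → ℝ) x ≠ 0 ↔
      Surjective (mfderiv I (𝓡 1) f (proj x)) := by
  -- the four differentials
  have hfd : MDifferentiableAt I (𝓡 1) f (proj x) := (hf (proj x)).mdifferentiableAt (by simp)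
  have hpd : MDifferentiableAt I I (proj : CyclicCover f → X) x :=
    (contMDiff_cyclicCover_proj f (I := I) (n := ∞) x).mdifferentiableAt (by simp)
  have hld : MDifferentiableAt I 𝓘(ℝ, ℝ) (level : CyclicCover f → ℝ) x :=
    (contMDiff_level f hf x).mdifferentiableAt (by simp)
  have hed : MDifferentiableAt 𝓘(ℝ, ℝ) (𝓡 1) Circle.exp (level x) :=
    (contMDiff_circleExp (m := 1)).mdifferentiableAt one_ne_zero
  have hbij := bijective_mfderiv_cyclicCover_proj f (I := I) (n := ∞) (by simp) x
  have hinj := injective_mfderiv_circleExp (level x)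
  -- `f ∘ proj = exp ∘ level` and its differential
  have hfun : (fun y : CyclicCover f ↦ f (proj y)) = fun y ↦ Circle.exp (level y) :=
    funext fun y ↦ apply_proj y
  have hchain : ∀ v : TangentSpace I x,
      (mfderiv I (𝓡 1) f (proj x) (mfderiv I I (proj : CyclicCover f → X) x v) :
        EuclideanSpace ℝ (Fin 1)) =
      mfderiv 𝓘(ℝ, ℝ) (𝓡 1) Circle.exp (level x)
        (mfderiv I 𝓘(ℝ, ℝ) (level : CyclicCover f → ℝ) x v) := fun v ↦ by
    have h1 : mfderiv I (𝓡 1) (fun y : CyclicCover f ↦ f (proj y)) x =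
        (mfderiv I (𝓡 1) f (proj x)).comp (mfderiv I I (proj : CyclicCover f → X) x) :=
      mfderiv_comp x hfd hpd
    have h2 : mfderiv I (𝓡 1) (fun y : CyclicCover f ↦ Circle.exp (level y)) x =
        (mfderiv 𝓘(ℝ, ℝ) (𝓡 1) Circle.exp (level x)).comp
          (mfderiv I 𝓘(ℝ, ℝ) (level : CyclicCover f → ℝ) x) :=
      mfderiv_comp x hed hld
    have h3 := congrArg (fun φ : CyclicCover f → Circle ↦
      (mfderiv I (𝓡 1) φ x v : EuclideanSpace ℝ (Fin 1))) hfun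
    simp only at h3
    rw [h1, h2] at h3
    exact h3
  rw [surjective_mfderiv_circle_iff_ne_zero]
  constructor
  · -- `d level ≠ 0`: pick `v` with `d level v ≠ 0`; then `df (dproj v) ≠ 0`
    intro hl hf0
    apply hl
    ext v
    have h := hchain v
    rw [hf0, zero_apply] at h
    have h0 : mfderiv I 𝓘(ℝ, ℝ) (level : CyclicCover f → ℝ) x v = 0 := by
      apply hinj
      rw [← h, map_zero]
      rfl
    rw [h0]
    rfl
  · -- `df ≠ 0`: pick `w = dproj v` with `df w ≠ 0`; then `d level v ≠ 0`
    intro hf0 hl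
    apply hf0
    ext w
    obtain ⟨v, rfl⟩ := hbij.2 w
    have h := hchain v
    rw [hl, zero_apply, map_zero] at h
    rw [zero_apply]
    exact congrArg (fun u : EuclideanSpace ℝ (Fin 1) ↦ u) h

/-- **The level function has no critical points iff `f` is a submersion** (`proj` is onto).
[cite: LeeSmoothManifolds2013, Thm. 4.29] -/
theorem forall_mfderiv_level_ne_zero_iff (hf : ContMDiff I (𝓡 1) ∞ f) :
    (∀ x : CyclicCover f, mfderiv I 𝓘(ℝ, ℝ) (level : CyclicCover f → ℝ) x ≠ 0) ↔
      ∀ y : X, Surjective (mfderiv I (𝓡 1) f y) := by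
  constructor
  · intro h y
    obtain ⟨x, rfl⟩ := proj_surjective (f := f) y
    exact (mfderiv_level_ne_zero_iff f hf x).1 (h x)
  · intro h x
    exact (mfderiv_level_ne_zero_iff f hf x).2 (h (proj x))

end Level

end Literature.Geometry.Manifold
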